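import Summits.HodgeConjecture.HodgeConjecture.Theorems.K2E3WittBoundedPivot                    -- (this seat) T2 F2: `exists_frame_pivot`
import Summits.HodgeConjecture.HodgeConjecture.Theorems.K2E3WittBoundedStep                     -- (this seat) T2 F3: `exists_conj_eigen_of_frame_pivot`
import Summits.HodgeConjecture.HodgeConjecture.Theorems.K2E3WittHermFormStd                     -- ★ (K2E3-p23): `transpose_map_wittFormOn`
import Summits.HodgeConjecture.HodgeConjecture.Theorems.K2E3QuasiSplitUnitaryCartanAnyInvolution  -- ★ p856681 (this seat): `apply_eq_of_mulVec_single`, `perm_inv_rev`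
import HarnessLib

/-!
# The BOUNDED (compact-set currency) Cartan decomposition of `U(σ, wittFormOn e Han)(K)` for an ARBITRARY anisotropic kernel and ANY isometric involution:
# the raw letter `hrawΩ` (crux H413, U12-g ∕ 13a road A, hand (T2) — the `m = 2`, wildly ramified places; K2E3-p10 (g3) RULINGS #13 (3))

Cell `hodgecm-mathlib`, Track B «K2-LIT», line `K2_E3_EllipticInputs`, 13a road A; seat K2E3-p09 (g3).  THEOREMS ONLY; `--supports stmt-HodgeConjecture-24833 --as helper`.

MAIN THEOREM **`exists_bounded_frameDiag`**.  `K` a field with `Valued K ℤᵐ⁰`, `σ` an involution with `v ∘ σ = v`, `Han` a σ-hermitian invertible `m × m` matrix,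
`B ≥ 1` ONE constant with `v(Han) ≤ B`, `v(Han⁻¹) ≤ B` and the COERCIVITY `v(z_u)² ≤ B · v(Han(z, z))` (so `Han` is anisotropic; over a non-archimedean local field
every anisotropic `Han` admits such a `B`, ★ `exists_forall_v_sq_le_v_hermForm_self`).  Then for every `r` there is `n : ℕ` such that for every standard indexing
`e : WittIndex r m ≃ Fin N` and every `g ∈ U(σ, wittFormOn e Han)` there are `k₁, k₂ ∈ U(σ, W)` with ALL ENTRIES BOUNDED BY `B ^ n` and

  `k₁ g k₂` FRAME-DIAGONAL:  `(k₁ g k₂)_{pq} = 0` whenever `p ≠ q` and `p` or `q` is a frame slot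

(so `k₁ g k₂ = diag(d) on the frame ⊕ (an element of U(Han)) on the kernel`; the entries of `k_i⁻¹` are then bounded by `B^{n+2}`, ★ F1 `v_inv_apply_le`).  With
`Ω := {k ∈ U : v(k_{ij}), v(k⁻¹_{ij}) ≤ B^{n+2}}` (compact over a local field, ★ `isCompact_setOf_v_apply_le_exp`) this is the raw weak Cartan decomposition
`U = Ω · (T · U(Han)) · Ω` — the letter `hrawΩ` for the compact-SET road ★ p856653 (`hG` after cone sorting), valid at EVERY place: no uniformiser, no (trace), no
(norm), no integrality or maximality of the kernel lattice (which fail at the wild `m = 2` places: K2 bus 2026-09-04T02:32Z).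
Proof: induction on `r` exactly as ★ p856681 (`r = 0`: nothing to do; step: near-maximal frame pivot ★ F2 — or `g` is already `B`-bounded and `k₁ = g⁻¹` —, kernel-fixing
Weyl permutations ★ F1, bounded elimination ★ F3, block structure of the eigen-element (§1), the middle block is `U(σ, W′)` (★ `exists_unitary_coe_eq_midBlock`), induction,
block-diagonal lifts ★ `exists_unitary_coe_eq_blockDiagMatrix`); the exponent grows by `7` per step.

HONEST LABEL: structure theorem, count-neutral; HC_CM is proved only modulo the 7 printed citations (2 remaining named inputs: hLiu418 = stmt-HodgeConjecture-24832,
h413 = stmt-HodgeConjecture-24833) until rung 0 closes; 13a itself stays open at the `m = 2` places until the packaging (cone sorting, `hGC`, `hLevi` in set currency) lands.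

References: F. Bruhat, J. Tits, *Groupes réductifs sur un corps local I* (1972), (4.4.3); J. Tits, *Reductive groups over local fields* (1979), §3.3.3; V. Platonov,
A. Rapinchuk, *Algebraic Groups and Number Theory* (1994), §3.1; J. Rogawski, *Automorphic representations of unitary groups in three variables* (1990), §1.9–§1.10.
-/

set_option autoImplicit false
-- the mandated namespace repeats `HodgeConjecture.HodgeConjecture`, as in every `Theorems/*.lean` of this sub-problem
set_option linter.dupNamespace false

noncomputable section

open scoped Valued WithZero Matrix MatrixGroups
open Matrix

namespace Summit.HodgeConjecture.HodgeConjecture.Cruxes.H413.K2E3WittBoundedCartan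

open Literature.NumberTheory.Automorphic Literature.NumberTheory.Automorphic.UnitaryGroup Literature.NumberTheory.Automorphic.HermitianLattice
open K2E3LocalUnitaryWitt K2E3WittCartanUnramified K2E3WittParabolicBlocks K2E3WittParabolicBlocksLift K2E3WittFrameTools K2E3WittBoundedPivot K2E3WittBoundedStep

/-! ## §1 Block bookkeeping for `c = 1` -/

section Blocks

variable {K : Type*} [Field K] (σ : K →+* K) {N r m : ℕ} (e : WittIndex r m ≃ Fin N)
  (hstd : ∀ x, (e x).val = Sum.elim (fun i : Fin r => i.val) (Sum.elim (fun u : Fin m => r + u.val) (fun j : Fin r => r + m + j.val)) x)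
  (Han : Matrix (Fin m) (Fin m) K)

omit σ e Han in
/-- Products of block-diagonal matrices are block-diagonal. [folklore] -/
theorem mul_apply_eq_zero_of_blockLabel_ne {c : ℕ} {M M' : Matrix (Fin N) (Fin N) K} (hM : ∀ {p q : Fin N}, blockLabel N c p ≠ blockLabel N c q → M p q = 0)
    (hM' : ∀ {p q : Fin N}, blockLabel N c p ≠ blockLabel N c q → M' p q = 0) {p q : Fin N} (hpq : blockLabel N c p ≠ blockLabel N c q) : (M * M') p q = 0 := by
  rw [Matrix.mul_apply]
  refine Finset.sum_eq_zero fun k _ => ?_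
  by_cases hk : blockLabel N c p = blockLabel N c k
  · rw [hM' (fun h => hpq (hk.trans h)), mul_zero]
  · rw [hM hk, zero_mul]

omit σ e Han in
/-- Block-diagonal matrices are block upper triangular. [folklore] -/
theorem blockTriangular_of_blockLabel_ne {c : ℕ} {M : Matrix (Fin N) (Fin N) K} (hM : ∀ {p q : Fin N}, blockLabel N c p ≠ blockLabel N c q → M p q = 0) :
    M.BlockTriangular (blockLabel N c) := fun _ _ h => hM h.ne'

include hstd in
/-- **An element of `U(σ, W)` with `q e₀ = λ e₀`, `q e_{N−1} = μ e_{N−1}` (`λ, μ ≠ 0`) is block diagonal for `(1 ∣ N−2 ∣ 1)`** — columns from the hypotheses, rows from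
the columns `λ⁻¹ e₀`, `μ⁻¹ e_{N−1}` of `q⁻¹` through ★ F1 `inv_apply_frame_frame` (frame slots) and `kernel_row_eq` (kernel slots). [cite: BruhatTits1972, (4.4.3)] -/
theorem apply_eq_zero_of_eigen (hHan : IsUnit Han.det) (hc : 2 * 1 ≤ N) (q : unitaryGroupOfForm σ (wittFormOn e Han)) {lam mu : K} (hlam : lam ≠ 0) (hmu : mu ≠ 0)
    (h0 : ((q : GL (Fin N) K) : Matrix (Fin N) (Fin N) K) *ᵥ Pi.single (⟨0, by omega⟩ : Fin N) 1 = lam • Pi.single (⟨0, by omega⟩ : Fin N) 1)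
    (hL : ((q : GL (Fin N) K) : Matrix (Fin N) (Fin N) K) *ᵥ Pi.single (Fin.rev (⟨0, by omega⟩ : Fin N)) 1 = mu • Pi.single (Fin.rev (⟨0, by omega⟩ : Fin N)) 1)
    (hz : ∀ u : Fin m, (⟨0, by omega⟩ : Fin N) ≠ e (Sum.inr (Sum.inl u))) {p p' : Fin N} (hpp' : blockLabel N 1 p ≠ blockLabel N 1 p') :
    ((q : GL (Fin N) K) : Matrix (Fin N) (Fin N) K) p p' = 0 := by
  set z : Fin N := ⟨0, by omega⟩ with hzdef
  set Q : Matrix (Fin N) (Fin N) K := ((q : GL (Fin N) K) : Matrix (Fin N) (Fin N) K) with hQ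
  have hzr := frame_rev e hstd hz
  -- the columns of `q⁻¹`
  have hinv : ∀ {c : K} {k : Fin N}, c ≠ 0 → Q *ᵥ Pi.single k 1 = c • Pi.single k 1 →
      (((q⁻¹ : unitaryGroupOfForm σ (wittFormOn e Han)) : GL (Fin N) K) : Matrix (Fin N) (Fin N) K) *ᵥ Pi.single k 1 = c⁻¹ • Pi.single k 1 := by
    intro c k hc0 hk
    have h : (((q⁻¹ : unitaryGroupOfForm σ (wittFormOn e Han)) : GL (Fin N) K) : Matrix (Fin N) (Fin N) K) *ᵥ (Q *ᵥ Pi.single k 1) =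
        (((q⁻¹ : unitaryGroupOfForm σ (wittFormOn e Han)) : GL (Fin N) K) : Matrix (Fin N) (Fin N) K) *ᵥ (c • Pi.single k 1) := by rw [hk]
    rw [Matrix.mulVec_mulVec, Subgroup.coe_inv, ← Units.val_mul, inv_mul_cancel, Units.val_one, Matrix.one_mulVec, Matrix.mulVec_smul] at h
    rw [Subgroup.coe_inv]
    calc ((((q : GL (Fin N) K)⁻¹ : GL (Fin N) K)) : Matrix (Fin N) (Fin N) K) *ᵥ Pi.single k 1
        = c⁻¹ • (c • (((((q : GL (Fin N) K)⁻¹ : GL (Fin N) K)) : Matrix (Fin N) (Fin N) K) *ᵥ Pi.single k 1)) := by rw [smul_smul, inv_mul_cancel₀ hc0, one_smul]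
      _ = c⁻¹ • Pi.single k 1 := by rw [← h]
  have hi0 := hinv hlam h0
  have hiL := hinv hmu hL
  -- label values
  have hlabz : ∀ k : Fin N, blockLabel N 1 k = 0 ↔ k = z := fun k => by
    rw [blockLabel_eq_zero_iff]; constructor
    · intro h; exact Fin.ext (by change (k : ℕ) = 0; omega)
    · intro h; rw [h]; change (0 : ℕ) < 1; omega
  have hlabL : ∀ k : Fin N, blockLabel N 1 k = 2 ↔ k = Fin.rev z := fun k => by
    rw [blockLabel_eq_two_iff hc]; constructor
    · intro h; exact Fin.ext (by rw [Fin.val_rev]; change (k : ℕ) = N - (0 + 1); omega)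
    · intro h; rw [h, Fin.val_rev]; change N ≤ N - (0 + 1) + 1; omega
  -- column `z` and column `rev z`
  have hcolz : ∀ i, i ≠ z → Q i z = 0 := fun i hi => by rw [K2E3QuasiSplitUnitaryCartanAnyInvolution.apply_eq_of_mulVec_single h0 i, Pi.single_eq_of_ne hi, mul_zero]
  have hcolL : ∀ i, i ≠ Fin.rev z → Q i (Fin.rev z) = 0 := fun i hi => by
    rw [K2E3QuasiSplitUnitaryCartanAnyInvolution.apply_eq_of_mulVec_single hL i, Pi.single_eq_of_ne hi, mul_zero]
  have hicolz : ∀ i, i ≠ z → (((q⁻¹ : unitaryGroupOfForm σ (wittFormOn e Han)) : GL (Fin N) K) : Matrix (Fin N) (Fin N) K) i z = 0 := fun i hi => by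
    rw [K2E3QuasiSplitUnitaryCartanAnyInvolution.apply_eq_of_mulVec_single hi0 i, Pi.single_eq_of_ne hi, mul_zero]
  have hicolL : ∀ i, i ≠ Fin.rev z → (((q⁻¹ : unitaryGroupOfForm σ (wittFormOn e Han)) : GL (Fin N) K) : Matrix (Fin N) (Fin N) K) i (Fin.rev z) = 0 := fun i hi => by
    rw [K2E3QuasiSplitUnitaryCartanAnyInvolution.apply_eq_of_mulVec_single hiL i, Pi.single_eq_of_ne hi, mul_zero]
  -- row `z` and row `rev z`, frame and kernel columns
  have hrow : ∀ {a : Fin N} (ha : a = z ∨ a = Fin.rev z) (j : Fin N), j ≠ a → Q a j = 0 := by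
    intro a ha j hja
    have haf : ∀ u : Fin m, a ≠ e (Sum.inr (Sum.inl u)) := by rcases ha with rfl | rfl <;> assumption
    have hicol : ∀ i, i ≠ Fin.rev a → (((q⁻¹ : unitaryGroupOfForm σ (wittFormOn e Han)) : GL (Fin N) K) : Matrix (Fin N) (Fin N) K) i (Fin.rev a) = 0 := by
      rcases ha with rfl | rfl
      · exact hicolL
      · rw [Fin.rev_rev]; exact hicolz
    by_cases hj : ∀ u : Fin m, j ≠ e (Sum.inr (Sum.inl u))
    · have h := inv_apply_frame_frame σ e hstd Han hHan q (frame_rev e hstd hj) (frame_rev e hstd haf)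
      rw [Fin.rev_rev, Fin.rev_rev, hicol _ (fun h' => hja (Fin.rev_injective h'))] at h
      exact (map_eq_zero_iff σ σ.injective).1 h.symm
    · push Not at hj
      obtain ⟨u, rfl⟩ := hj
      have h := kernel_row_eq σ e hstd Han q haf u
      have hker : ∀ u' : Fin m, e (Sum.inr (Sum.inl u')) ≠ Fin.rev a := by
        intro u' h'
        rcases ha with rfl | rfl
        · exact hzr u' h'.symm
        · rw [Fin.rev_rev] at h'; exact hz u' h'.symm
      rw [Finset.sum_eq_zero (fun u' _ => by rw [hicol _ (hker u'), mul_zero])] at h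
      exact (map_eq_zero_iff σ σ.injective).1 h
  -- case analysis on the labels
  have hp2 := blockLabel_le_two (c := 1) p
  have hp'2 := blockLabel_le_two (c := 1) p'
  rcases Nat.lt_or_ge (blockLabel N 1 p) 1 with hp0 | hp1
  · have hpz : p = z := (hlabz p).1 (by omega)
    exact hrow (Or.inl hpz) p' (fun h => hpp' (by rw [h]))
  · rcases Nat.lt_or_ge (blockLabel N 1 p') 1 with hq0 | hq1
    · have hqz : p' = z := (hlabz p').1 (by omega)
      rw [hqz]; exact hcolz p (fun h => hpp' (by rw [h, hqz]))
    · -- one of them has label 2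
      by_cases hp2' : blockLabel N 1 p = 2
      · have hpL : p = Fin.rev z := (hlabL p).1 hp2'
        exact hrow (Or.inr hpL) p' (fun h => hpp' (by rw [h]))
      · have hq2' : blockLabel N 1 p' = 2 := by omega
        have hqL : p' = Fin.rev z := (hlabL p').1 hq2'
        rw [hqL]; exact hcolL p (fun h => hpp' (by rw [h, hqL]))

include hstd in
/-- **Frame slots of the middle block correspond**: if `midIndex j` is a frame slot of `e` then `j` is a frame slot of the shifted standard indexing `e′`.
[cite: Borel1991, §23] -/
theorem frame_of_frame_midIndex (hcr : 1 ≤ r) (hc : 2 * 1 ≤ N) (hN' : (r - 1) + (m + (r - 1)) = N - 2 * 1) {j : Fin (N - 2 * 1)}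
    (hj : ∀ u : Fin m, midIndex hc j ≠ e (Sum.inr (Sum.inl u))) : ∀ u : Fin m, j ≠ stdWittEquivFin (r - 1) m hN' (Sum.inr (Sum.inl u)) := by
  intro u h
  have key := symm_midIndex_eq e hstd hcr hc hN' j
  rw [h, Equiv.symm_apply_apply] at key
  simp only [Sum.elim_inr, Sum.elim_inl] at key
  have key2 : midIndex hc (stdWittEquivFin (r - 1) m hN' (Sum.inr (Sum.inl u))) = e (Sum.inr (Sum.inl u)) := by
    have h2 := congrArg e key
    rwa [Equiv.apply_symm_apply] at h2
  exact hj u (by rw [h]; exact key2)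

variable [Valued K ℤᵐ⁰]

omit e Han in
/-- **Entries of the lift `diag(1, κ, 1†)` are bounded by those of `κ`** (and by `1`). [cite: Rogawski1990, §1.10] -/
theorem v_blockDiagMatrix_one_le (hc : 2 * 1 ≤ N) (κ : Matrix (Fin (N - 2 * 1)) (Fin (N - 2 * 1)) K) {X : ℤᵐ⁰} (hX1 : 1 ≤ X) (hκ : ∀ i j, Valued.v (κ i j) ≤ X)
    (p q : Fin N) :
    Valued.v (blockDiagMatrix hc (((1 : GL (Fin 1) K)) : Matrix (Fin 1) (Fin 1) K) κ (dualBlock σ (((1 : GL (Fin 1) K)⁻¹ : GL (Fin 1) K) : Matrix (Fin 1) (Fin 1) K)) p q) ≤ X := by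
  have h01 : ∀ x : K, (x = 0 ∨ x = 1) → Valued.v x ≤ X := by
    rintro x (rfl | rfl)
    · rw [map_zero]; exact zero_le
    · rw [map_one]; exact hX1
  by_cases hpq : blockLabel N 1 p = blockLabel N 1 q
  · obtain ⟨x, rfl⟩ := (blockSum hc).surjective p
    obtain ⟨y, rfl⟩ := (blockSum hc).surjective q
    rcases x with (x | x) | x <;> rcases y with (y | y) | y <;>
      simp only [blockSum_inl_inl, blockSum_inl_inr, blockSum_inr, blockLabel_castLE hc, blockLabel_midIndex hc, blockLabel_hiIndex hc] at hpq ⊢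
    all_goals first
      | exact absurd hpq (by decide)
      | (rw [blockDiagMatrix_castLE_castLE, Units.val_one]; exact h01 _ (by rw [Matrix.one_apply]; split_ifs <;> simp))
      | (rw [blockDiagMatrix_midIndex_midIndex]; exact hκ _ _)
      | (rw [blockDiagMatrix_hiIndex_hiIndex, dualBlock_apply, inv_one, Units.val_one]
         exact h01 _ (by rw [Matrix.one_apply]; split_ifs <;> simp))
  · rw [blockDiagMatrix_apply_of_ne hc _ _ _ hpq, map_zero]; exact zero_le

end Blocks

/-! ## §2 The bounded Cartan decomposition, by induction on the Witt index -/

section Main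

variable {K : Type*} [Field K] [Valued K ℤᵐ⁰] {σ : K →+* K} {m : ℕ} (Han : Matrix (Fin m) (Fin m) K)

/-- Powers of `B ≥ 1` are monotone and at least `1`. [folklore] -/
theorem le_pow_of_le_pow {B x : ℤᵐ⁰} (hB1 : 1 ≤ B) {a b : ℕ} (hab : a ≤ b) (h : x ≤ B ^ a) : x ≤ B ^ b := h.trans (pow_le_pow_right₀ hB1 hab)

/-- **THE BOUNDED CARTAN DECOMPOSITION (`hrawΩ`, frame-diagonal form) of `U(σ, wittFormOn e Han)(K)` — ANY anisotropic kernel, ANY isometric involution.**  See the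
module docstring. [cite: BruhatTits1972, (4.4.3)] [cite: Tits1979, §3.3.3] [cite: PlatonovRapinchuk1994, §3.1 Thm. 3.1] -/
theorem exists_bounded_frameDiag (hσ : ∀ x, σ (σ x) = x) (hvσ : ∀ x, Valued.v (σ x) = Valued.v x) (hHanh : (Han.map σ)ᵀ = Han) (hHan : IsUnit Han.det)
    {B : ℤᵐ⁰} (hB1 : 1 ≤ B) (hHanB : ∀ u u', Valued.v (Han u u') ≤ B) (hHaniB : ∀ u u', Valued.v (Han⁻¹ u u') ≤ B)
    (hcoer : ∀ (z : Fin m → K) (u : Fin m), Valued.v (z u) * Valued.v (z u) ≤ B * Valued.v (hermForm σ Han z z)) :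
    ∀ r : ℕ, ∃ n : ℕ, ∀ {N : ℕ} (e : WittIndex r m ≃ Fin N)
      (hstd : ∀ x, (e x).val = Sum.elim (fun i : Fin r => i.val) (Sum.elim (fun u : Fin m => r + u.val) (fun j : Fin r => r + m + j.val)) x)
      (g : unitaryGroupOfForm σ (wittFormOn e Han)),
      ∃ k₁ k₂ : unitaryGroupOfForm σ (wittFormOn e Han),
        (∀ i j, Valued.v (((k₁ : GL (Fin N) K) : Matrix (Fin N) (Fin N) K) i j) ≤ B ^ n) ∧
        (∀ i j, Valued.v (((k₂ : GL (Fin N) K) : Matrix (Fin N) (Fin N) K) i j) ≤ B ^ n) ∧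
        ∀ p q : Fin N, p ≠ q → ((∀ u : Fin m, p ≠ e (Sum.inr (Sum.inl u))) ∨ (∀ u : Fin m, q ≠ e (Sum.inr (Sum.inl u)))) →
          (((k₁ * g * k₂ : unitaryGroupOfForm σ (wittFormOn e Han)) : GL (Fin N) K) : Matrix (Fin N) (Fin N) K) p q = 0 := by
  intro r
  induction r with
  | zero =>
    refine ⟨0, fun {N} e hstd g => ⟨1, 1, fun i j => ?_, fun i j => ?_, fun p q _ hpq => ?_⟩⟩
    · rw [OneMemClass.coe_one, Units.val_one, Matrix.one_apply, pow_zero]; split_ifs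
      · rw [map_one]
      · rw [map_zero]; exact zero_le_one
    · rw [OneMemClass.coe_one, Units.val_one, Matrix.one_apply, pow_zero]; split_ifs
      · rw [map_one]
      · rw [map_zero]; exact zero_le_one
    · -- no frame slots when `r = 0`
      exfalso
      have hall : ∀ p : Fin N, ∃ u : Fin m, p = e (Sum.inr (Sum.inl u)) := fun p => by
        obtain ⟨x, rfl⟩ := e.surjective p
        rcases x with i | u | j
        · exact i.elim0
        · exact ⟨u, rfl⟩
        · exact j.elim0
      rcases hpq with h | h
      · obtain ⟨u, hu⟩ := hall p; exact h u hu
      · obtain ⟨u, hu⟩ := hall q; exact h u hu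
  | succ r IH =>
    obtain ⟨n, hn⟩ := IH
    refine ⟨n + 7, fun {N} e hstd g => ?_⟩
    have hN : N = (r + 1) + (m + (r + 1)) := by simpa using (Fintype.card_congr e).symm
    have hc : 2 * 1 ≤ N := by omega
    have hcr : 1 ≤ r + 1 := by omega
    have hN' : (r + 1 - 1) + (m + (r + 1 - 1)) = N - 2 * 1 := by omega
    set z : Fin N := ⟨0, by omega⟩ with hzdef
    have hz : ∀ u : Fin m, z ≠ e (Sum.inr (Sum.inl u)) := (frame_iff e hstd z).2 (Or.inl (by change 0 < r + 1; omega))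
    have hzr := frame_rev e hstd hz
    have hW : ∀ p q, Valued.v (wittFormOn e Han p q) ≤ B := v_wittFormOn_le e hstd Han hB1 hHanB
    have hWi : ∀ p q, Valued.v (wittFormOn e Han⁻¹ p q) ≤ B := v_wittFormOn_le e hstd Han⁻¹ hB1 hHaniB
    have hWh : ((wittFormOn e Han).map σ)ᵀ = wittFormOn e Han := K2E3WittHermFormStd.transpose_map_wittFormOn σ e Han hHanh
    have hB7 : ∀ {x : ℤᵐ⁰} {a : ℕ}, a ≤ n + 7 → x ≤ B ^ a → x ≤ B ^ (n + 7) := fun ha hx => le_pow_of_le_pow hB1 ha hx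
    rcases exists_frame_pivot σ e hstd Han hvσ hB1 hHanB hcoer hHan g with hbd | ⟨s, t, hs, ht, hst, hle⟩
    · -- `g` is `B`-bounded: `k₁ = g⁻¹`, `k₂ = 1`
      refine ⟨g⁻¹, 1, fun i j => hB7 (a := 3) (by omega) ?_, fun i j => hB7 (a := 0) (by omega) ?_, fun p q hpq _ => ?_⟩
      · have h := v_inv_apply_le σ e Han hvσ hHan g hW hWi hbd i j
        calc _ ≤ B * B * B := h
          _ = B ^ 3 := by rw [pow_succ, pow_two]
      · rw [OneMemClass.coe_one, Units.val_one, Matrix.one_apply, pow_zero]; split_ifs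
        · rw [map_one]
        · rw [map_zero]; exact zero_le_one
      · rw [inv_mul_cancel, one_mul, OneMemClass.coe_one, Units.val_one, Matrix.one_apply_ne hpq]
    · -- the pivot case
      have hvst0 : Valued.v (((g : GL (Fin N) K) : Matrix (Fin N) (Fin N) K) s t) ≠ 0 := (Valuation.ne_zero_iff _).2 hst
      -- Weyl moves: `ρ z = s`, `τ z = t`
      obtain ⟨ρ, hρ, hρk, hρz⟩ := exists_perm_frame e hstd hcr hs
      obtain ⟨τ, hτ, hτk, hτz⟩ := exists_perm_frame e hstd hcr ht
      have hτ' := K2E3QuasiSplitUnitaryCartanAnyInvolution.perm_inv_rev hτ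
      have hτk' := perm_inv_kernel e hτk
      set P₁ : unitaryGroupOfForm σ (wittFormOn e Han) := ⟨permGL ρ, permGL_mem_unitaryGroupOfForm_witt σ e hstd Han ρ hρ hρk⟩ with hP₁
      set P₂ : unitaryGroupOfForm σ (wittFormOn e Han) := ⟨permGL τ⁻¹, permGL_mem_unitaryGroupOfForm_witt σ e hstd Han τ⁻¹ hτ' hτk'⟩ with hP₂
      set g₁ : unitaryGroupOfForm σ (wittFormOn e Han) := P₁ * g * P₂ with hg₁
      have hg₁entry : ∀ i j, ((g₁ : GL (Fin N) K) : Matrix (Fin N) (Fin N) K) i j = ((g : GL (Fin N) K) : Matrix (Fin N) (Fin N) K) (ρ i) (τ j) := by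
        intro i j
        rw [hg₁, Subgroup.coe_mul, Subgroup.coe_mul, Units.val_mul, Units.val_mul]
        change (((permGL ρ : GL (Fin N) K) : Matrix (Fin N) (Fin N) K) * ((g : GL (Fin N) K) : Matrix (Fin N) (Fin N) K) *
          ((permGL τ⁻¹ : GL (Fin N) K) : Matrix (Fin N) (Fin N) K)) i j = _
        rw [permGL_mul_mul_permGL_apply, Equiv.Perm.inv_def, Equiv.symm_symm]
      have hzz : ((g₁ : GL (Fin N) K) : Matrix (Fin N) (Fin N) K) z z = ((g : GL (Fin N) K) : Matrix (Fin N) (Fin N) K) s t := by rw [hg₁entry, hρz, hτz]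
      have hle₁ : ∀ i j, Valued.v (((g₁ : GL (Fin N) K) : Matrix (Fin N) (Fin N) K) i j) ≤ B * B * Valued.v (((g₁ : GL (Fin N) K) : Matrix (Fin N) (Fin N) K) z z) :=
        fun i j => by rw [hg₁entry, hzz]; exact hle _ _
      have hzz0 : ((g₁ : GL (Fin N) K) : Matrix (Fin N) (Fin N) K) z z ≠ 0 := by rw [hzz]; exact hst
      -- the bounds with `C = B⁴`
      have hB24 : B * B ≤ B ^ 4 := by
        calc B * B = B ^ 2 := (pow_two B).symm
          _ ≤ B ^ 4 := pow_le_pow_right₀ hB1 (by omega)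
      have hC1 : (1 : ℤᵐ⁰) ≤ B ^ 4 := one_le_pow₀ hB1
      have hleC : ∀ i j, Valued.v (((g₁ : GL (Fin N) K) : Matrix (Fin N) (Fin N) K) i j) ≤ B ^ 4 * Valued.v (((g₁ : GL (Fin N) K) : Matrix (Fin N) (Fin N) K) z z) :=
        fun i j => (hle₁ i j).trans (mul_le_mul' hB24 le_rfl)
      have hleiC : ∀ i j, Valued.v ((((g₁⁻¹ : unitaryGroupOfForm σ (wittFormOn e Han)) : GL (Fin N) K) : Matrix (Fin N) (Fin N) K) i j) ≤
          B ^ 4 * Valued.v (((g₁ : GL (Fin N) K) : Matrix (Fin N) (Fin N) K) z z) := fun i j => by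
        have h := v_inv_apply_le σ e Han hvσ hHan g₁ hW hWi hle₁ i j
        calc _ ≤ B * (B * B * Valued.v (((g₁ : GL (Fin N) K) : Matrix (Fin N) (Fin N) K) z z)) * B := h
          _ = B ^ 4 * Valued.v (((g₁ : GL (Fin N) K) : Matrix (Fin N) (Fin N) K) z z) := by
              rw [show B ^ 4 = B * B * B * B by rw [pow_succ, pow_succ, pow_two]]; ac_rfl
      -- the elimination step
      obtain ⟨ω₁, ω₂, hω₁, hω₂, hq0, hqL⟩ := exists_conj_eigen_of_frame_pivot e hstd Han hσ hvσ hWh hHan hB1 hC1 hW g₁ hz hz hzz0 hleC hleiC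
      set q : unitaryGroupOfForm σ (wittFormOn e Han) := ω₁⁻¹ * g₁ * ω₂ with hq
      set lam : K := ((g₁ : GL (Fin N) K) : Matrix (Fin N) (Fin N) K) z z with hlam
      have hσlam0 : (σ lam)⁻¹ ≠ 0 := inv_ne_zero ((map_ne_zero σ).2 hzz0)
      -- block structure of `q`
      have hqblk : ∀ {p p' : Fin N}, blockLabel N 1 p ≠ blockLabel N 1 p' → ((q : GL (Fin N) K) : Matrix (Fin N) (Fin N) K) p p' = 0 :=
        fun hpp' => apply_eq_zero_of_eigen σ e hstd Han hHan hc q hzz0 hσlam0 hq0 hqL hz hpp'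
      have hqBT := blockTriangular_of_blockLabel_ne hqblk
      -- the middle block and the induction hypothesis
      obtain ⟨g', hg'⟩ := exists_unitary_coe_eq_midBlock e hstd Han hcr hc hN' hHan q hqBT
      have hstd' := stdWittEquivFin_hstd (r + 1 - 1) m hN'
      have hrr : r + 1 - 1 = r := by omega
      obtain ⟨κ₁, κ₂, hκ₁, hκ₂, hdiag'⟩ := hn (stdWittEquivFin (r + 1 - 1) m hN') hstd' g'
      -- the lifts
      obtain ⟨L₁, hL₁⟩ := exists_unitary_coe_eq_blockDiagMatrix e hstd Han hcr hc hN' hσ hHan (1 : GL (Fin 1) K) κ₁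
      obtain ⟨L₂, hL₂⟩ := exists_unitary_coe_eq_blockDiagMatrix e hstd Han hcr hc hN' hσ hHan (1 : GL (Fin 1) K) κ₂
      have hBn1 : (1 : ℤᵐ⁰) ≤ B ^ n := one_le_pow₀ hB1
      have hL₁bd : ∀ i j, Valued.v (((L₁ : GL (Fin N) K) : Matrix (Fin N) (Fin N) K) i j) ≤ B ^ n := fun i j => by
        rw [hL₁]; exact v_blockDiagMatrix_one_le σ hc _ hBn1 hκ₁ i j
      have hL₂bd : ∀ i j, Valued.v (((L₂ : GL (Fin N) K) : Matrix (Fin N) (Fin N) K) i j) ≤ B ^ n := fun i j => by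
        rw [hL₂]; exact v_blockDiagMatrix_one_le σ hc _ hBn1 hκ₂ i j
      have hL₁blk : ∀ {p p' : Fin N}, blockLabel N 1 p ≠ blockLabel N 1 p' → ((L₁ : GL (Fin N) K) : Matrix (Fin N) (Fin N) K) p p' = 0 := fun h => by
        rw [hL₁]; exact blockDiagMatrix_apply_of_ne hc _ _ _ h
      have hL₂blk : ∀ {p p' : Fin N}, blockLabel N 1 p ≠ blockLabel N 1 p' → ((L₂ : GL (Fin N) K) : Matrix (Fin N) (Fin N) K) p p' = 0 := fun h => by
        rw [hL₂]; exact blockDiagMatrix_apply_of_ne hc _ _ _ h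
      -- the answer
      refine ⟨L₁ * ω₁⁻¹ * P₁, P₂ * ω₂ * L₂, fun i j => ?_, fun i j => ?_, fun p p' hpp' hfr => ?_⟩
      · -- bound for `k₁`
        have hω₁i : ∀ i j, Valued.v ((((ω₁⁻¹ : unitaryGroupOfForm σ (wittFormOn e Han)) : GL (Fin N) K) : Matrix (Fin N) (Fin N) K) i j) ≤ B ^ 7 := fun i j => by
          have h := v_inv_apply_le σ e Han hvσ hHan ω₁ hW hWi hω₁ i j
          calc _ ≤ B * (B ^ 4 * B) * B := h
            _ = B ^ 7 := by rw [show B ^ 7 = B ^ 4 * B * B * B by rw [pow_succ, pow_succ, pow_succ]]; ac_rfl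
        rw [Subgroup.coe_mul, Subgroup.coe_mul, Units.val_mul, Units.val_mul]
        calc _ ≤ B ^ n * B ^ 7 * 1 := v_mul_apply_le (v_mul_apply_le hL₁bd hω₁i) (fun i j => v_permGL_apply_le_one ρ i j) i j
          _ = B ^ (n + 7) := by rw [mul_one, pow_add]
      · -- bound for `k₂`
        rw [Subgroup.coe_mul, Subgroup.coe_mul, Units.val_mul, Units.val_mul]
        calc _ ≤ 1 * (B ^ 4 * B) * B ^ n := v_mul_apply_le (v_mul_apply_le (fun i j => v_permGL_apply_le_one τ⁻¹ i j) hω₂) hL₂bd i j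
          _ = B ^ (n + 5) := by rw [one_mul, ← pow_succ, ← pow_add, add_comm]
          _ ≤ B ^ (n + 7) := pow_le_pow_right₀ hB1 (by omega)
      · -- frame-diagonality of `X = L₁ q L₂`
        have hX : L₁ * ω₁⁻¹ * P₁ * g * (P₂ * ω₂ * L₂) = L₁ * q * L₂ := by rw [hq, hg₁]; group
        rw [hX, Subgroup.coe_mul, Subgroup.coe_mul, Units.val_mul, Units.val_mul]
        by_cases hlab : blockLabel N 1 p = blockLabel N 1 p'
        · -- same label: `0` and `2` are singletons, label `1` is the middle block
          have hp2 := blockLabel_le_two (c := 1) p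
          rcases Nat.lt_or_ge (blockLabel N 1 p) 1 with h0 | h1
          · exfalso; apply hpp'
            have h1 : (p : ℕ) < 1 := (blockLabel_eq_zero_iff p).1 (by omega)
            have h2 : (p' : ℕ) < 1 := (blockLabel_eq_zero_iff p').1 (by omega)
            exact Fin.ext (by omega)
          · by_cases h2 : blockLabel N 1 p = 2
            · exfalso; apply hpp'
              have h3 := (blockLabel_eq_two_iff hc p).1 h2
              have h4 := (blockLabel_eq_two_iff hc p').1 (hlab ▸ h2)
              exact Fin.ext (by have := p.isLt; have := p'.isLt; omega)
            · have hl1 : blockLabel N 1 p = 1 := by omega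
              have hl1' : blockLabel N 1 p' = 1 := hlab ▸ hl1
              obtain ⟨hpc, hpc'⟩ := (blockLabel_eq_one_iff p).1 hl1
              obtain ⟨hqc, hqc'⟩ := (blockLabel_eq_one_iff p').1 hl1'
              obtain ⟨j, rfl⟩ : ∃ j, midIndex hc j = p := ⟨⟨p - 1, by omega⟩, Fin.ext (by simp; omega)⟩
              obtain ⟨j', rfl⟩ : ∃ j', midIndex hc j' = p' := ⟨⟨p' - 1, by omega⟩, Fin.ext (by simp; omega)⟩
              have hjj' : j ≠ j' := fun h => hpp' (by rw [h])
              change midBlock hc (((L₁ : GL (Fin N) K) : Matrix (Fin N) (Fin N) K) * _ * _) j j' = 0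
              rw [midBlock_mul hc ((blockTriangular_of_blockLabel_ne hL₁blk).mul hqBT) (blockTriangular_of_blockLabel_ne hL₂blk),
                midBlock_mul hc (blockTriangular_of_blockLabel_ne hL₁blk) hqBT, hL₁, hL₂, midBlock_blockDiagMatrix, midBlock_blockDiagMatrix, ← hg']
              have h := hdiag' j j' hjj' (by
                rcases hfr with h | h
                · exact Or.inl (frame_of_frame_midIndex e hstd hcr hc hN' h)
                · exact Or.inr (frame_of_frame_midIndex e hstd hcr hc hN' h))
              rwa [Subgroup.coe_mul, Subgroup.coe_mul, Units.val_mul, Units.val_mul] at h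
        · exact mul_apply_eq_zero_of_blockLabel_ne (fun h => mul_apply_eq_zero_of_blockLabel_ne hL₁blk hqblk h) hL₂blk hlab

end Main

end Summit.HodgeConjecture.HodgeConjecture.Cruxes.H413.K2E3WittBoundedCartan

end
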